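import Summits.Ventures.CertifiedManyBodySolver.Downfold.WorkedExamplePass
import Summits.Ventures.CertifiedManyBodySolver.Downfold.PhaseMapLowTCoverage

/-!
# ACCEPTANCE v1.9 ITEM 8 on §14 WORKED EXAMPLE 3: invisible to PASS-TV3-LK99, a coverage requirement on PASS-TV3-Cu
# (hubbard-downfold-score-2 g11; regression scenarios S106–S108)

Venture CertifiedManyBodySolver, cell `pub/hubbard-downfold`; namespace
`Summit.Ventures.CertifiedManyBodySolver.Downfold.WorkedExample` (REUSES `Control`, `tv3LK99`, `tv3Cu` of
`WorkedExamplePass.lean` and score-1's item-8 model `CellScore.verdict8` / `lowTCovered` / `sparseAllNot` of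
`PhaseMapLowTCoverage.lean`). Context (2026-08-27): deputy-2's v1.9 draft-5 (= draft-4 + ITEM 8 «§4.5 NOT needs low-T
coverage», 08:39:50Z) was dry-run over score-2's §14 regression suite; the registered expectation flips on the two worked-example-3
controls (PREREG §E; scenarios S106 sparse Cu / S107 low-T-present Cu / S108 sparse LK-99) printed exactly as registered: a sparse
Cu map loses PASS-TV3-Cu, a sparse LK-99 map keeps PASS-TV3-LK99. Everything below is PROVED; nothing is about a material.

WHAT THIS IS NOT: not the ruling (item 8 issues with ACCEPTANCE v1.9 after the freeze run), not a claim that any map of record is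
sparse (none is: every assembly carries T22), and not an objection to the asymmetry — it is §14's own letter («Cu: verdict TN»;
«LK-99: TN or honest ABSTAIN») read against item 8 as exact statements:

* §1 `Control.kind8`, `tv3LK99₈`, `tv3Cu₈` = the two PASS-TV3 clauses with the item-8 verdict in place of the v1.8 verdict.
* §2 property sheet: `kind8_eq_TN_iff` (an item-8 TN = a v1.8 TN WITH low-T coverage); **`tv3LK99_item8_invariant`: item 8 never
  changes PASS-TV3-LK99 on ANY control** (its kind clause accepts TN or ABSTAIN, and item 8 only moves TN to ABSTAIN);
  **`tv3Cu8_eq_PASS_iff`: PASS-TV3-Cu under item 8 = PASS-TV3-Cu under v1.8 AND low-T coverage** — so coverage is NECESSARY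
  (`tv3Cu8_eq_FAIL_of_not_covered`) and item 8 is the identity on covered columns (`tv3Cu8_eq_tv3Cu_of_covered`), in particular on T22.
* §3 the three regression shapes evaluated: `cuSparse` (S106: v1.8 PASS, item 8 FAIL; kind TN → ABSTAIN), `cuLowTPresent` (S107: PASS
  under both), `lk99Sparse` (S108: PASS under both although its kind goes TN → ABSTAIN) = `item8_asymmetry_on_worked_example_3`.
-/

namespace Summit.Ventures.CertifiedManyBodySolver.Downfold

namespace WorkedExample

open CellScore

/-! ## §1 The PASS-TV3 clauses under item 8 -/

/-- the §4.5 verdict kind of a control under ACCEPTANCE v1.9 item 8 (truth class: not a known superconductor). [folklore] -/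
def Control.kind8 (c : Control) : Kind := CellScore.kind (CellScore.verdict8 c.Tfloor c.cells c.bands) false

/-- PASS-TV3 LK-99 with the item-8 verdict (all other conjuncts verbatim). [folklore] -/
def tv3LK99₈ (c : Control) : Pass :=
  if c.wellFormed && !anySC c.cells && !anyBandReaches c.bands
      && (decide (c.kind8 = Kind.TN) || decide (c.kind8 = Kind.ABSTAIN))
      && decide (c.router = RouterScore.Outcome.AGREE) && c.hClean
  then .PASS else .FAIL

/-- PASS-TV3 Cu with the item-8 verdict (all other conjuncts verbatim). [folklore] -/
def tv3Cu₈ (c : Control) : Pass :=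
  if c.wellFormed && decide (c.kind8 = Kind.TN) && allNotFromTenth c.cells && !c.falseBand
      && decide (c.router = RouterScore.Outcome.AGREE)
  then .PASS else .FAIL

/-! ## §2 Property sheet -/

/-- on the non-superconductor truth class, kind TN is exactly verdict NOT. [folklore] -/
theorem kind_false_eq_TN_iff {v : Verdict} : CellScore.kind v false = Kind.TN ↔ v = Verdict.NOT := by
  cases v <;> simp [CellScore.kind]

/-- the item-8 kind is the v1.8 kind or ABSTAIN (score-1's `kind_verdict8`, restated for a control). [folklore] -/
theorem kind8_eq_or (c : Control) : c.kind8 = c.kind ∨ c.kind8 = Kind.ABSTAIN :=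
  kind_verdict8 (Tfloor := c.Tfloor) (cells := c.cells) (bands := c.bands) false

/-- an item-8 TN is a v1.8 TN WITH low-temperature coverage. [folklore] -/
theorem kind8_eq_TN_iff (c : Control) : c.kind8 = Kind.TN ↔ c.kind = Kind.TN ∧ lowTCovered c.Tfloor c.cells = true := by
  rw [Control.kind8, Control.kind, kind_false_eq_TN_iff, kind_false_eq_TN_iff, verdict8_eq_NOT_iff]

/-- if the item-8 kind is ABSTAIN, the v1.8 kind was TN or ABSTAIN (item 8 only demotes NOT). [folklore] -/
theorem kind_of_kind8_eq_ABSTAIN {c : Control} (h : c.kind8 = Kind.ABSTAIN) : c.kind = Kind.TN ∨ c.kind = Kind.ABSTAIN := by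
  have hv : verdict8 c.Tfloor c.cells c.bands = .UNDETERMINED := kind_eq_ABSTAIN_iff.mp h
  unfold verdict8 at hv
  split_ifs at hv with hc
  · exact Or.inl (kind_false_eq_TN_iff.mpr hc.1)
  · exact Or.inr (by rw [Control.kind, hv]; rfl)

/-- the kind conjunct of PASS-TV3-LK99 reads the same under item 8. [folklore] -/
theorem lk99KindClause_item8 (c : Control) :
    (decide (c.kind8 = Kind.TN) || decide (c.kind8 = Kind.ABSTAIN))
      = (decide (c.kind = Kind.TN) || decide (c.kind = Kind.ABSTAIN)) := by
  rcases kind8_eq_or c with h | h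
  · rw [h]
  · have h' := kind_of_kind8_eq_ABSTAIN h
    rw [h]
    rcases h' with h' | h' <;> simp [h']

/-- **ITEM 8 IS INVISIBLE TO PASS-TV3-LK99**: for every control, the clause's value is unchanged (§14 lets the not-replicated
claim be met by TN or by an honest ABSTAIN, and item 8 only turns TN into ABSTAIN). [folklore] -/
theorem tv3LK99_item8_invariant (c : Control) : tv3LK99₈ c = tv3LK99 c := by
  simp only [tv3LK99₈, tv3LK99, lk99KindClause_item8]

/-- **PASS-TV3-Cu UNDER ITEM 8 = PASS-TV3-Cu UNDER v1.8 ∧ LOW-T COVERAGE.** [folklore] -/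
theorem tv3Cu8_eq_PASS_iff (c : Control) :
    tv3Cu₈ c = .PASS ↔ tv3Cu c = .PASS ∧ lowTCovered c.Tfloor c.cells = true := by
  have hk := kind8_eq_TN_iff c
  by_cases h8 : c.kind8 = Kind.TN
  · obtain ⟨hk1, hcov⟩ := hk.mp h8
    simp [tv3Cu₈, tv3Cu, h8, hk1, hcov]
  · have : ¬(c.kind = Kind.TN ∧ lowTCovered c.Tfloor c.cells = true) := fun h => h8 (hk.mpr h)
    by_cases hk1 : c.kind = Kind.TN
    · have hcov : lowTCovered c.Tfloor c.cells = false := by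
        cases hc : lowTCovered c.Tfloor c.cells
        · rfl
        · exact absurd ⟨hk1, hc⟩ this
      simp [tv3Cu₈, tv3Cu, h8, hcov]
    · simp [tv3Cu₈, tv3Cu, h8, hk1]

/-- coverage is NECESSARY for the Cu control under item 8: no owed low-T point set, no PASS. [folklore] -/
theorem tv3Cu8_eq_FAIL_of_not_covered {c : Control} (h : lowTCovered c.Tfloor c.cells = false) : tv3Cu₈ c = .FAIL := by
  have h8 : c.kind8 ≠ Kind.TN := fun hk => by
    have hc := ((kind8_eq_TN_iff c).mp hk).2
    rw [h] at hc
    exact Bool.false_ne_true hc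
  simp [tv3Cu₈, h8]

/-- on a covered column (in particular a T22 column) item 8 is the identity on PASS-TV3-Cu. [folklore] -/
theorem tv3Cu8_eq_tv3Cu_of_covered {c : Control} (h : lowTCovered c.Tfloor c.cells = true) : tv3Cu₈ c = tv3Cu c := by
  have h8 : c.kind8 = c.kind := by
    rw [Control.kind8, Control.kind, verdict8_eq_verdict_of_covered h]
  simp only [tv3Cu₈, tv3Cu, h8]

/-- … so on every assembled map of record (grid ⊇ T22) worked example 3 reads the same under v1.8 and under item 8. [folklore] -/
theorem tv3Cu8_eq_tv3Cu_of_T22 {c : Control} (h : ∀ T ∈ T22, ∃ x ∈ c.cells, x.1 = T) : tv3Cu₈ c = tv3Cu c :=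
  tv3Cu8_eq_tv3Cu_of_covered (lowTCovered_of_T22_subset h)

/-! ## §3 The three regression shapes (S106 / S107 / S108), evaluated -/

/-- S106: Cu (T_min 10 μK), every cell «not» on score-1's sparse grid {0, 130, …, 400}, no band, router AGREE. [folklore] -/
def cuSparse : Control := ⟨true, .AGREE, true, 1 / 100000, sparseAllNot, [], false⟩

/-- S107: Cu, every cell «not» on {0, 0.1, 0.3, 1, 2, 4, 6, 10, 130, …, 400} (only 15–100 K dropped from T22). [folklore] -/
def cuLowTPresent : Control :=
  ⟨true, .AGREE, true, 1 / 100000,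
    column (fun _ => Word.not) ([0, 1 / 10, 3 / 10, 1, 2, 4, 6, 10, 130, 160, 200, 250, 300, 350, 400] : List ℚ), [], false⟩

/-- S108: LK-99 (T_min 2 K), every cell «not» on the sparse grid, no band, router AGREE. [folklore] -/
def lk99Sparse : Control := ⟨true, .AGREE, true, 2, sparseAllNot, [], false⟩

/-- S106 evaluated: v1.8 TN / PASS-TV3-Cu PASS; item 8: ABSTAIN / FAIL (the owed points 0.1 … 10 K are absent). [folklore] -/
theorem cuSparse_eval :
    cuSparse.kind = Kind.TN ∧ tv3Cu cuSparse = .PASS ∧ cuSparse.kind8 = Kind.ABSTAIN ∧ tv3Cu₈ cuSparse = .FAIL := by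
  refine ⟨by decide +kernel, by decide +kernel, by decide +kernel, by decide +kernel⟩

/-- S107 evaluated: TN and PASS under v1.8 AND under item 8 (every owed point present). [folklore] -/
theorem cuLowTPresent_eval :
    cuLowTPresent.kind = Kind.TN ∧ tv3Cu cuLowTPresent = .PASS
      ∧ cuLowTPresent.kind8 = Kind.TN ∧ tv3Cu₈ cuLowTPresent = .PASS := by
  refine ⟨by decide +kernel, by decide +kernel, by decide +kernel, by decide +kernel⟩

/-- S108 evaluated: the kind goes TN → ABSTAIN under item 8, PASS-TV3-LK99 is PASS under both. [folklore] -/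
theorem lk99Sparse_eval :
    lk99Sparse.kind = Kind.TN ∧ tv3LK99 lk99Sparse = .PASS ∧ lk99Sparse.kind8 = Kind.ABSTAIN ∧ tv3LK99₈ lk99Sparse = .PASS := by
  refine ⟨by decide +kernel, by decide +kernel, by decide +kernel, by decide +kernel⟩

/-- **THE DESIGNED ASYMMETRY OF ITEM 8 ON WORKED EXAMPLE 3** (regression S106 vs S108): on the SAME sparse all-«not» column the Cu
control flips PASS → FAIL while the LK-99 control stays PASS. [folklore] -/
theorem item8_asymmetry_on_worked_example_3 :
    (tv3Cu cuSparse = .PASS ∧ tv3Cu₈ cuSparse = .FAIL) ∧ (tv3LK99 lk99Sparse = .PASS ∧ tv3LK99₈ lk99Sparse = .PASS) :=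
  ⟨⟨cuSparse_eval.2.1, cuSparse_eval.2.2.2⟩, ⟨lk99Sparse_eval.2.1, lk99Sparse_eval.2.2.2⟩⟩

end WorkedExample

end Summit.Ventures.CertifiedManyBodySolver.Downfold
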